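import Summits.QuantumFields.BalabanUV.Beta.GAN24.CubicReadoutCoDressed
import Summits.QuantumFields.BalabanUV.Beta.GAN24.StencilSlotLam
import Summits.QuantumFields.BalabanUV.Beta.HessKerCoDressedBmWall
import Summits.QuantumFields.BalabanUV.Beta.HessKerUnitsOnlyK

/-!
# `BalabanUV.Beta.GAN24.SrecUnits` — binder row G-an2-4 / (CONV-C), S-slot on the literal of record (family (E), `WardLocusRecursive.SrecAt`):
# THE CUBIC SECTOR OF THE RECURSION IN THE ADOPTED UNITS IS SELF-SIMILAR — `unitS_{j+1} (cE·wE (j+1) • e3OfK Lc G_j S_j) = (cE·Lc^{2(d+1)}) •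
# e3K (KStepUnit Lc j) Lc (𝔇 (unitS_j S_j))`: a `j`-FREE weight times ONE fixed functional of the K-slot's unit step resolvent applied to the
# block-mean-dressed, unit-rescaled previous member (row SR-L0 «UNITS ENGINE», cubic line, of `HOME/b2b-balaban-gan24-p1/SKELETON-SREC.md` v0.1;
# unit `b2b-balaban-gan24-p1`, gen 12)

NOT IN PRINT; OUR BOOKKEEPING.  HONEST FRAMING (cell contract, verbatim): «discharging `BetaPertH` makes Bałaban's UV stability UNCONDITIONAL —
a real constructive-QFT result; it is NOT the continuum limit and NOT the Clay problem.»  HONEST DEPENDENCY (verbatim): «continuum YM on T⁴ ⇐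
BetaPertH ∧ nine spine estimates (0/9 proved); BetaPertH ⇐ (D1) ∧ (D4) ∧ CAP+tail; G-an2-4 gates asym, D1 and NE2/3/4.»  [folklore] units algebra
over the tree's definitions BY NAME — asym1's `HessKerDressedUnits.unitS`/`unitK`/`legScale`, leaf-05's `ThirdJetKernel.e3K_unit`/`e3K_smul`, the row
owner's gen-3 `StencilSlotLam.unitS_smul_ffOnly` (twin: Λ-summand `unitS_lamPiece_eq`, constant `cΛ·Lc^{2(d+1)}`), asym1's
`HessKerCoDressedBmWall.unitK_coDressKBmAt`, gen 12's `CubicReadoutCoDressed.e3K_coDressKBmAt`, an2's weight `BalabanStepJetsSucc.wE = (Lc^n)^{3(d+2)}`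
and the adopted units `CombesThomas.sfStep = Lc^n`, `smStep = Lc^{n(d+1)}`, `KStepUnit`.  Generic `d`, generic kernel/table where stated; NO estimate,
NO cited fact, NO `def`, NO `def … : Prop`, NO wall binder; reserved families untouched.  Discharges NOTHING of (hS, hSall) on (E); NOT BetaPertH,
NOT continuum, NOT Clay.

## The finding (kernel-checked below)
* `e3K_of_units`: `e3K K L S = (s_m⁻¹)² • e3K (unitK s_f s_m K) L (unitS s_f s_m S)` (any nonzero units; `e3K_unit` at the inverse units + `unitK_inv_unitK` /
  `unitS_inv_unitS`).
* `cubic_unit_factor`: `(s_f′s_m′)⁻¹·s_f′⁻²·(c·wE (j+1))·(s_m j)⁻² = c·Lc^{2(d+1)}` at the adopted units — the KERNEL CHECK of an2's numeral `wE = (Lc^n)^{3(d+2)}`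
  against the K-slot's units: every power of `Lc^j` cancels; the `j`-FREE `Lc^{2(d+1)}` is the SAME factor as the Λ-summand's (`StencilSlotLam.lam_unit_factor`)
  and as the top border piece's (`TopBorderKSlot.unit_e3OfS_borderInc_top`).
* **`unitS_cubicPiece_eq`** (generic `G`, `S`, weight `c`): `unitS (sfStep Lc (j+1)) (smStep d Lc (j+1)) (fun κ u ↦ (c·wE d Lc (j+1)) • e3K G Lc S κ u)
  = fun κ u ↦ (c·Lc^{2(d+1)}) • e3K (unitK (sfStep Lc j) (smStep d Lc j) G) Lc (unitS (sfStep Lc j) (smStep d Lc j) S) κ u`.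
* **`unitS_cubicPiece_coDressed_eq`** (the literal's shape: `G := coDressKBmAt ρ Lc (KInvStep Lc j)`, any local `S`, in-block root):
  `… = fun κ u ↦ (c·Lc^{2(d+1)}) • e3K (KStepUnit Lc j) Lc (fun κ u ↦ dressKBmAt ρ Lc (coProjBmAtK ρ Lc (unitS_j S) κ u)) κ u` — the self-similar form
  `S̃_{j+1}^{cubic} = c₃ • 𝒜⁰_j[𝔇 S̃_j]` of SKELETON-SREC §1.3 with `c₃ = cE·Lc^{2(d+1)}` DISPLAYED and `𝒜⁰_j` the cubic read-out through the UNDRESSED unit step resolvent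
  `KStepUnit Lc j` (road P1's K-slot object: `UnitDecayK`, `CauchyDecayK` at `d = 3`).
* `unitS_SrecAt_succ_cubic`: the same for `S := SrecAt d Lc (toSite r) cE cVH cΛ j`, `c := cE` (leaf-10's `locStencil_SrecAt` supplies the locality).
READING: with `StencilSlotLam.unitS_lamPiece_eq` (Λ line, rooted twin pending) and `StencilSlotVH`'s border line (rooted twin pending), the WHOLE recursion
`SrecAt` in units is an affine map with `j`-free weights `(cE·Lc^{2(d+1)}, cVH, cΛ·Lc^{2(d+1)})` driven by K-slot objects only — (U0) of SKELETON-SREC §3,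
EXCEPT the coherence question (is `cE = Lc^{d+1}` the value at which the marginal sector of `𝒜⁰_j ∘ 𝔇` has eigenvalue `1`), which is an eigenvalue of a
FIXED map and is NOT decided by units algebra.
-/

noncomputable section

open Finset
open scoped BigOperators
open Literature.MathematicalPhysics.QuantumFieldTheory
open Literature.MathematicalPhysics.QuantumFieldTheory.Balaban1983to89
open Literature.MathematicalPhysics.QuantumFieldTheory.Balaban1983to89.Beta
open ExpKernelCalculus (MKer Decays BiLoc comp)
open AffineAveraging (box toSite)
open OneStepResolventKernel (Fib LocStencil)
open OneStepKernelFamily (KInvStep decays_KInvStep vertexOfK)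
open BalabanStepJetsSucc (wE)
open Summit.QuantumFields.BalabanUV.Beta.HessKerDressedUnits (unitK unitS counitK legScale unitS_apply unitK_apply counitK_apply legScale_inl
  legScale_inr decays_unitK locStencil_unitS)
open Summit.QuantumFields.BalabanUV.Beta.GAN24.CombesThomas (sfStep smStep sfStep_ne_zero smStep_ne_zero KStepUnit)
open Summit.QuantumFields.BalabanUV.Beta.GAN24.ThirdJetKernel (e3K e3K_unit e3K_smul e3K_inl_inl e3K_inr_left e3K_inr_right)
open Summit.QuantumFields.BalabanUV.Beta.GAN24.StencilSlotLam (unitS_smul_ffOnly)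
open Summit.QuantumFields.BalabanUV.Beta.AxialDressingRooted (coDressKBmAt dressKBmAt coProjBmAtK)
open Summit.QuantumFields.BalabanUV.Beta.HessKerCoDressedBmWall (unitK_coDressKBmAt)
open Summit.QuantumFields.BalabanUV.Beta.HessKerUnitsOnlyK (unitS_inv_unitS)
open Summit.QuantumFields.BalabanUV.Beta.GAN24.CubicReadoutCoDressed (e3K_coDressKBmAt)
open Summit.QuantumFields.BalabanUV.Beta.WardLocusRecursive (SrecAt locStencil_SrecAt)

namespace Summit.QuantumFields.BalabanUV.Beta.GAN24.SrecUnits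

variable {d : ℕ}

/-! ## §1 Inverse units undo units -/

/-- [folklore] `D⁻¹ (D K D) D⁻¹ = K` (nonzero units). -/
theorem unitK_inv_unitK {sf sm : ℝ} (hsf : sf ≠ 0) (hsm : sm ≠ 0) (K : MKer (d + 1) (Fib d)) :
    unitK sf⁻¹ sm⁻¹ (unitK sf sm K) = K := by
  funext x y a b
  rw [unitK_apply, unitK_apply]
  rcases a with α | μ <;> rcases b with β | ν <;> simp only [legScale_inl, legScale_inr] <;> field_simp

/-- [folklore] **THE CUBIC READ-OUT IN TERMS OF THE RESCALED OBJECTS**: `e3K K L S = (s_m⁻¹)² • e3K (D K D) L (unitS S)`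
(`ThirdJetKernel.e3K_unit` at the inverse units). -/
theorem e3K_of_units {sf sm : ℝ} (hsf : sf ≠ 0) (hsm : sm ≠ 0) (K : MKer (d + 1) (Fib d)) (L : ℕ)
    (S : Fin (d + 1) → (Fin (d + 1) → ℤ) → MKer (d + 1) (Fib d)) (κ' : Fin (d + 1)) (u' : Fin (d + 1) → ℤ) :
    e3K K L S κ' u' = fun x z a b => sm⁻¹ ^ 2 * e3K (unitK sf sm K) L (unitS sf sm S) κ' u' x z a b := by
  have h := e3K_unit (inv_ne_zero hsf) (inv_ne_zero hsm) (unitK sf sm K) L (unitS sf sm S) κ' u'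
  rw [unitK_inv_unitK hsf hsm, unitS_inv_unitS hsf hsm] at h
  exact h

/-! ## §2 The scalar: an2's `wE` against the adopted units -/

section Scalar

variable {Lc : ℕ} [NeZero Lc]

/-- [folklore] **(U-E‴) THE CUBIC UNIT FACTOR**: `(s_f′s_m′)⁻¹·(s_f′⁻¹·s_f′⁻¹)·(c·wE (j+1))·(s_m j)⁻¹² = c·Lc^{2(d+1)}` at `s_f n = Lc^n`, `s_m n = Lc^{n(d+1)}`,
`wE n = (Lc^n)^{3(d+2)}` — every power of `Lc^j` cancels; `j`-FREE. -/
theorem cubic_unit_factor (c : ℝ) (j : ℕ) :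
    (sfStep Lc (j + 1) * smStep d Lc (j + 1))⁻¹ * ((sfStep Lc (j + 1))⁻¹ * (sfStep Lc (j + 1))⁻¹) * (c * wE d Lc (j + 1)) *
        (smStep d Lc j)⁻¹ ^ 2 = c * (Lc : ℝ) ^ (2 * (d + 1)) := by
  have hL : (Lc : ℝ) ≠ 0 := Nat.cast_ne_zero.2 (NeZero.ne Lc)
  have h1 : wE d Lc (j + 1) = (sfStep Lc (j + 1) * smStep d Lc (j + 1)) * (sfStep Lc (j + 1) * sfStep Lc (j + 1)) *
      (smStep d Lc j) ^ 2 * (Lc : ℝ) ^ (2 * (d + 1)) := by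
    simp only [sfStep, smStep, wE, ← pow_add, ← pow_mul]
    ring_nf
  have hsf : sfStep Lc (j + 1) ≠ 0 := sfStep_ne_zero (j + 1)
  have hsm : smStep d Lc (j + 1) ≠ 0 := smStep_ne_zero (d := d) (j + 1)
  have hsmj : smStep d Lc j ≠ 0 := smStep_ne_zero (d := d) j
  rw [h1]
  field_simp

end Scalar

/-! ## §3 The cubic summand of the recursion in units (generic kernel and table) -/

section Generic

variable {Lc : ℕ} [NeZero Lc]

/-- [folklore] **SELF-SIMILARITY OF THE CUBIC SUMMAND** (generic `G`, `S`, weight `c`): rescaling member `j+1`'s cubic summand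
`(c·wE (j+1)) • e3K G Lc S` to the units of step `j+1` gives `(c·Lc^{2(d+1)}) •` the cubic read-out through the UNIT-RESCALED kernel of the UNIT-RESCALED
table of step `j` — a `j`-FREE weight (`unitS_smul_ffOnly`: `e3K` is field–field-valued; `e3K_of_units`; `cubic_unit_factor`). -/
theorem unitS_cubicPiece_eq (c : ℝ) (j : ℕ) (G : MKer (d + 1) (Fib d)) (S : Fin (d + 1) → (Fin (d + 1) → ℤ) → MKer (d + 1) (Fib d)) :
    unitS (sfStep Lc (j + 1)) (smStep d Lc (j + 1)) (fun κ u => (c * wE d Lc (j + 1)) • e3K G Lc S κ u)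
      = fun κ u => (c * (Lc : ℝ) ^ (2 * (d + 1))) •
          e3K (unitK (sfStep Lc j) (smStep d Lc j) G) Lc (unitS (sfStep Lc j) (smStep d Lc j) S) κ u := by
  have hsfj : sfStep Lc j ≠ 0 := sfStep_ne_zero j
  have hsmj : smStep d Lc j ≠ 0 := smStep_ne_zero (d := d) j
  rw [unitS_smul_ffOnly _ _ _ (fun κ u => e3K G Lc S κ u) (fun κ u x y α ν => e3K_inr_right G Lc S κ u x y (Sum.inl α) ν)
    (fun κ u x y ν α => e3K_inr_left G Lc S κ u x y ν (Sum.inl α)) (fun κ u x y ν ν' => e3K_inr_left G Lc S κ u x y ν (Sum.inr ν'))]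
  funext κ u x z a b
  simp only [Pi.smul_apply, smul_eq_mul]
  rw [e3K_of_units hsfj hsmj G Lc S κ u, ← cubic_unit_factor (d := d) (Lc := Lc) c j]
  ring

end Generic

/-! ## §4 The literal's shape: the co-dressed step resolvent -/

section CoDressed

variable {Lc : ℕ} [NeZero Lc] {r : Fin (d + 1) → ℕ} {S : Fin (d + 1) → (Fin (d + 1) → ℤ) → MKer (d + 1) (Fib d)} {Cs δ : ℝ}

/-- [folklore] The unit step resolvent IS `unitK` of the step resolvent (pin, `rfl`). -/
theorem KStepUnit_eq (j : ℕ) : KStepUnit (d := d) Lc j = unitK (sfStep Lc j) (smStep d Lc j) (KInvStep (d := d) Lc j) := rfl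

/-- [folklore] **THE CUBIC SUMMAND OVER THE CO-DRESSED STEP RESOLVENT, IN UNITS, IS `c·Lc^{2(d+1)} •` THE READ-OUT THROUGH THE UNDRESSED UNIT STEP
RESOLVENT OF THE DRESSED, RESCALED TABLE**: for an in-block root `r`, any local `S`, weight `c`,
`unitS_{j+1} ((c·wE (j+1)) • e3K (coDressKBmAt ρ Lc (KInvStep Lc j)) Lc S) = (c·Lc^{2(d+1)}) • e3K (KStepUnit Lc j) Lc (𝔇 (unitS_j S))`,
`𝔇 T κ u := dressKBmAt ρ Lc (coProjBmAtK ρ Lc T κ u)` (`unitS_cubicPiece_eq`; asym1's `unitK_coDressKBmAt`: units commute with the co-dressing; gen 12's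
`CubicReadoutCoDressed.e3K_coDressKBmAt`: co-dressing the kernel = dressing the table; `decays_unitK ∘ decays_KInvStep`, `locStencil_unitS`). -/
theorem unitS_cubicPiece_coDressed_eq (hr : r ∈ box (d + 1) Lc) (hS : LocStencil S Cs δ) (hδ : 0 < δ) (c : ℝ) (j : ℕ) :
    unitS (sfStep Lc (j + 1)) (smStep d Lc (j + 1))
        (fun κ u => (c * wE d Lc (j + 1)) • e3K (coDressKBmAt (toSite r) Lc (KInvStep (d := d) Lc j)) Lc S κ u)
      = fun κ u => (c * (Lc : ℝ) ^ (2 * (d + 1))) •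
          e3K (KStepUnit (d := d) Lc j) Lc
            (fun κ u => dressKBmAt (toSite r) Lc (coProjBmAtK (toSite r) Lc (unitS (sfStep Lc j) (smStep d Lc j) S) κ u)) κ u := by
  have hLc : 1 ≤ Lc := Nat.one_le_iff_ne_zero.2 (NeZero.ne Lc)
  have hsfj : sfStep Lc j ≠ 0 := sfStep_ne_zero j
  have hsmj : smStep d Lc j ≠ 0 := smStep_ne_zero (d := d) j
  obtain ⟨δK, CK, hδK, _, hK⟩ := decays_KInvStep (d := d) (Lc := Lc) j
  have hKu := decays_unitK (sf := sfStep Lc j) (sm := smStep d Lc j) hK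
  have hSu := locStencil_unitS (sf := sfStep Lc j) (sm := smStep d Lc j) hS
  rw [unitS_cubicPiece_eq c j, unitK_coDressKBmAt (toSite r) Lc hsfj hsmj (KInvStep (d := d) Lc j)]
  funext κ u
  rw [e3K_coDressKBmAt hLc hr hKu hδK hSu hδ κ u, ← KStepUnit_eq]

/-- [folklore] **AT THE LITERAL OF RECORD**: member `j+1`'s cubic summand of leaf-10's `SrecAt` (weight `cE·wE (j+1)`, kernel `coDressKBmAt ρ Lc (KInvStep Lc j)`,
table `SrecAt … j`; `WardLocusRecursive.SrecAt_succ`, an2's `e3OfK` = leaf-05's `e3K` by `CubicReadoutDecLift.e3OfK_eq_e3K`), in the adopted units: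
`(cE·Lc^{2(d+1)}) • e3K (KStepUnit Lc j) Lc (𝔇 (unitS_j (SrecAt … j)))` — `j` enters ONLY through `KStepUnit Lc j` (road P1's K-slot object) and the
previous rescaled member. -/
theorem unitS_SrecAt_succ_cubic (hr : r ∈ box (d + 1) Lc) (cE cVH cΛ : ℝ) (j : ℕ) :
    unitS (sfStep Lc (j + 1)) (smStep d Lc (j + 1))
        (fun κ u => (cE * wE d Lc (j + 1)) •
          e3K (coDressKBmAt (toSite r) Lc (KInvStep (d := d) Lc j)) Lc (SrecAt d Lc (toSite r) cE cVH cΛ j) κ u)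
      = fun κ u => (cE * (Lc : ℝ) ^ (2 * (d + 1))) •
          e3K (KStepUnit (d := d) Lc j) Lc
            (fun κ u => dressKBmAt (toSite r) Lc
              (coProjBmAtK (toSite r) Lc (unitS (sfStep Lc j) (smStep d Lc j) (SrecAt d Lc (toSite r) cE cVH cΛ j)) κ u)) κ u := by
  obtain ⟨Cs, δ, hδ, hS⟩ := locStencil_SrecAt (d := d) (Lc := Lc) (Nat.one_le_iff_ne_zero.2 (NeZero.ne Lc)) hr cE cVH cΛ j
  exact unitS_cubicPiece_coDressed_eq hr hS hδ cE j

end CoDressed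

end Summit.QuantumFields.BalabanUV.Beta.GAN24.SrecUnits

end
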